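import Summits.HodgeConjecture.HodgeConjecture.Theorems.F0P3ArchClassTokenOfRecord     -- ★ `clInfChoice`, `hasToken_rep_cl_iff`; cone: ★ T5-A `HasToken`∕`Cinf`∕`Gp`, ★ p819048 `Cls`∕`cl`∕`rep`, ★ `F0P3ArchTokenSeam`
import Summits.HodgeConjecture.HodgeConjecture.Theorems.F0P3ClassTokenChoice          -- ★ p819116 `clFinChoice`, `clFinChoice_isUnitarizable` (UNCONDITIONAL)
import Summits.HodgeConjecture.HodgeConjecture.Theorems.F0P3bArchDegOneClass          -- ★ X1′ p820619 `archDegOneClass`, `archDegOneClass_spec`; cone: ★ P3b `IsCohUnitaryIrrep`, `G21`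
import Summits.HodgeConjecture.HodgeConjecture.Theorems.F0P3ArchTokenUnitary          -- ★ `exists_cohUnitaryIrrep_token_of_isHolCotangentAt_cpt`; cone: ★ `archIsotypy_of_isHolCotangentAt` (F1a, hol)
import HarnessLib

/-!
# Crux `H413`, floor 0, programme F0P3 — «UL»: THE UNITARITY PREDICATE OF RECORD `unitaryLoc₀`, THE UNITARITY-FIRST ARCHIMEDEAN TOKEN
# `clInfChoiceU`, AND LAW `UnitaryCoord` AT `𝔠₀` UNCONDITIONALLY (rung 4, ED. 4 instance; PLAN.F0P3g5 §1 row 9 ∕ §5 K5; RULING (V33)(3))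

Cell hodgecm-mathlib (D-0151), sub-cell F0/P3 «U3-mult»; pen F0P3-p02 (g7); crux item stmt-HodgeConjecture-24833 (`HCCMUnconditional.H413`).
DEF lane (`--kind definition --supports stmt-HodgeConjecture-24833 --as helper`): three definitions WITH BODY (`IsCohUnitaryClass`, `unitaryLoc₀`,
`clInfChoiceU`) and their API; no instance, no notation, no named fact, no `sorry`; kit-free (imports ★ T5-A only through ★ `F0P3ArchClassTokenOfRecord`,
for the token predicate `HasToken`).

THE LAWS (dossier `Cruxes/H413/Lines/F0_T5InnerFormClassification.lean` v5): the kit FIELD `UnitaryLoc : ∀ S, Cinf × (∀ v : ↥S, IrrClass (G′_v)) → Prop` (:223,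
«every coordinate unitary»; Prop. 13.8.1 needs it), law `UnitaryCoord := ∀ S c, UnitaryLoc S (coordS S c)` (:407) with `coordS S c = (clInf c, fun v => clFin c v.1)`,
consumed UNGUARDED at every class of a ξ-fibre (`coefficientFormula_of_laws … (h6a : UnitaryCoord)`, :883).

CENSUS (this seat, bus 11:4xZ).  (1) ★ `IsUnitarizableGK` (BorelWallach2000/U11UnitaryDual :128) is `U(1,1)`-only; the ★ `U(2,1)` currency is P3b's
`IsCohUnitaryIrrep ρK ρ𝔤` (= `IsGKModule ∧ IsIrreducibleGK ∧ IsAdmissibleGK ∧ IsUnitaryAlongP`, ★ `F0P3bArchDegOnePackageDefs`) — the currency of X1′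
`archDegOneClass`, of ★ `F0P3ArchTokenUnitary` and of T6c; §1 lifts it to classes (`IsCohUnitaryClass`, ∃-form).  (2) With the FIRST arch token of record
`clInf₀ = clInfChoice dflt ∘ rep` (★ `F0P3ArchClassTokenOfRecord`: ANY token, else `dflt`) the arch half of `UnitaryCoord` is NOT unconditional: tokens are
★-unitary only for HOLOMORPHIC-cotangent `P`; for a general token-bearing class the chosen token's unitarity is Harish-Chandra's theorem [HarishChandra1953
Thm. 9], not in the tree.  (3) RESOLUTION = the RULING (V24)(d1) pattern (which made pins (iv)(v) unconditional through `clFinChoice`) applied to the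
ARCHIMEDEAN token: §3 `clInfChoiceU dflt P` := the class of a COH-UNITARY token of `P` if one exists, else `dflt` — a classical `if` over a proposition
true in every model of the printed facts (every archimedean component of an automorphic `π′` is unitary), NOT smuggling; then §4 `unitaryCoord₀` holds at
EVERY class BY CONSTRUCTION (0 letters), with `dflt := archDegOneClass 1` (★ coh-unitary) and the finite half ★ `clFinChoice_isUnitarizable` (all three
branches).  (4) PRICE: law `TokenInf` at `𝔠₀` (guard `IsCot`, RULING (V30)) must be re-proved for `clInfChoiceU` — §5: it holds for every `P` satisfying F1a
at the CM frame that HAS a coh-unitary token (`tokenInfU_of_exists_cohUnitaryToken`); the HOLOMORPHIC instance is ★ now (`…_of_isHolCotangentAt`, via ★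
`exists_cohUnitaryIrrep_token_of_isHolCotangentAt_cpt` + ★ `archIsotypy_of_isHolCotangentAt`); the ANTIHOLOMORPHIC instance needs the conjugation transport of
the hol coh-unitary token (sequel file, (B-ii)).

* §1 `IsCohUnitaryClass x` + `isCohUnitaryClass_mk ∕ _ofModule ∕ _archDegOneClass`.
* §2 `unitaryLoc₀ S x := IsCohUnitaryClass x.1 ∧ ∀ v : ↥S, (x.2 v).IsUnitarizable` + `unitaryLoc₀_iff`.
* §3 `clInfChoiceU dflt P` + `exists_spec_clInfChoiceU_eq`, `clInfChoiceU_of_not`, `isCohUnitaryClass_clInfChoiceU` (both branches).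
* §4 **`unitaryCoord₀ (hdflt) : ∀ S c, unitaryLoc₀ S (clInfChoiceU dflt (rep c), fun v => clFinChoice (rep c) v.1)`** — law `UnitaryCoord` at `𝔠₀` token for token
  (`clInf := clInfChoiceU dflt ∘ rep`, `clFin c v := clFinChoice (rep c) v`, `UnitaryLoc := unitaryLoc₀`), UNCONDITIONAL; `unitaryCoord₀_archDegOne` at `dflt := [J⁺]`.
* §5 `clInfChoiceU_eq_ofModule`, `tokenInfU_of_exists_cohUnitaryToken` (law `TokenInf` shape for `clInfChoiceU`, modulo F1a for `P` and ONE coh-unitary token),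
  **`tokenInfU_of_isHolCotangentAt`** (★ holomorphic instance, under `hdef`, `h2`).
HONEST LABEL: HC_CM is proved only modulo the printed citations until rung 0 closes; this file discharges none of them and asserts nothing (choices + specs).
References: J. Rogawski, Ann. of Math. Stud. 123 (1990), Prop. 13.8.1 p. 206, §14.5 p. 237, Prop. 15.2.1 (b) [Rogawski1990]; Harish-Chandra, TAMS 75 (1953),
Thm. 9 [HarishChandra1953]; A. Borel, N. Wallach, AMS (2000), 0 §2.5, VI Thm. 4.11 [BorelWallach2000]; D. Flath, PSPM 33.1 (1979) Thms. 3–4 [FlathCorvallis1979].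
-/

set_option autoImplicit false
-- the mandated namespace has the single-problem summit's repeated segment (`HodgeConjecture.HodgeConjecture`)
set_option linter.dupNamespace false

-- Mathlib idiom (Mathlib/Algebra/Lie/OfAssociative.lean; as in ★ `GKModules` and every `(𝔤, K)` file of the tree):
-- the commutator bracket on `Module.End ℂ M`, needed to MENTION `𝔲(2,1) →ₗ⁅ℝ⁆ Module.End ℂ M`.
attribute [local instance 100] LieRing.ofAssociativeRing

noncomputable section
namespace Summit.HodgeConjecture.HodgeConjecture.Cruxes.H413.F0P3UnitaryLocOfRecord

open scoped Matrix MatrixGroups ComplexOrder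
open MeasureTheory NumberField NumberField.InfinitePlace IsDedekindDomain
open Literature.NumberTheory.Automorphic Literature.NumberTheory.Automorphic.UnitaryGroup
open Literature.NumberTheory.Automorphic.UnitaryGroup.CotangentForms (cmArchSection cmCompactFactor)
open Literature.RepresentationTheory.BorelWallach2000
open Literature.RepresentationTheory.KonnoKonno2007 Literature.RepresentationTheory.KonnoKonno2007.RealDualPair Literature.RepresentationTheory.KonnoKonno2007.RealDualPair.UForm
open Summit.HodgeConjecture.HodgeConjecture.Cruxes.H413.F0P3InnerFormClassification (HasToken Cinf Gp)
open Summit.HodgeConjecture.HodgeConjecture.Cruxes.H413.F0P3ClassTokensOfRecord (Cls cl rep cl_rep)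
open Summit.HodgeConjecture.HodgeConjecture.Cruxes.H413.F0P3ClassTokenChoice (clFinChoice clFinChoice_isUnitarizable)
open Summit.HodgeConjecture.HodgeConjecture.Cruxes.H413.F0P3ArchClassTokenOfRecord (hasToken_rep_cl_iff)
open Summit.HodgeConjecture.HodgeConjecture.Cruxes.H413.F0P3bArchDegOnePackage (IsCohUnitaryIrrep)
open Summit.HodgeConjecture.HodgeConjecture.Cruxes.H413.F0P3bArchDegOneClass (archDegOneClass archDegOneClass_spec)

/-! ## §1 The class-level unitarity predicate on `Cinf` -/

/-- **`IsCohUnitaryClass x` — the archimedean class `x ∈ Cinf` is the class of an irreducible ADMISSIBLE `(𝔲(2,1), K)`-module UNITARY along `𝔭 ⊕ ℝz₀`**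
(P3b's ★ `IsCohUnitaryIrrep`, stated on SOME representative — an `∃`-form, so no quotient lift is needed).  In print: the class of the Harish-Chandra module
of an irreducible unitary representation of `U(2,1)` (the objects of Prop. 13.8.1). [cite: Rogawski1990, Prop. 13.8.1 p. 206] [cite: BorelWallach2000, 0 §2.5] -/
def IsCohUnitaryClass (x : Cinf) : Prop :=
  ∃ r : GKIrrep (uFormGroup (Fin 2) (Fin 1)), GKIrrClass.mk r = x ∧ IsCohUnitaryIrrep r.ρK r.ρ𝔤

/-- The class of a coh-unitary `GKIrrep` is coh-unitary. [cite: BorelWallach2000, 0 §2.5] -/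
theorem isCohUnitaryClass_mk {r : GKIrrep (uFormGroup (Fin 2) (Fin 1))} (h : IsCohUnitaryIrrep r.ρK r.ρ𝔤) : IsCohUnitaryClass (GKIrrClass.mk r) :=
  ⟨r, rfl, h⟩

/-- The class `GKIrrClass.ofModule M σK σ𝔤` of a coh-unitary module is coh-unitary. [cite: BorelWallach2000, 0 §2.5] -/
theorem isCohUnitaryClass_ofModule (M : Type) [AddCommGroup M] [Module ℂ M] (σK : Representation ℂ (uFormGroup (Fin 2) (Fin 1)).maximalCompact M)
    (σ𝔤 : (uFormGroup (Fin 2) (Fin 1)).lie →ₗ⁅ℝ⁆ Module.End ℂ M) (h : IsCohUnitaryIrrep σK σ𝔤) :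
    IsCohUnitaryClass (GKIrrClass.ofModule M σK σ𝔤 h.gk h.irred) := by
  rw [GKIrrClass.ofModule_eq_mk]
  exact ⟨_, rfl, h⟩

/-- **`[J^δ]` is coh-unitary** (★ X1′ `archDegOneClass_spec`: a coh-unitary representative). [cite: Rogawski1990, Prop. 15.2.1 (b)] -/
theorem isCohUnitaryClass_archDegOneClass (δ : ℤ) (hδ : δ = 1 ∨ δ = -1) : IsCohUnitaryClass (archDegOneClass δ hδ) := by
  obtain ⟨r, hr, -, hreq⟩ := archDegOneClass_spec δ hδ
  exact ⟨r, hreq, hr⟩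

/-! ## §2 The unitarity predicate of record `unitaryLoc₀` -/

section Frame

variable (L : Type) [Field L] [NumberField L] [IsCMField L] (H : Matrix (Fin 3) (Fin 3) L)

/-- **`unitaryLoc₀ S x` — THE `UnitaryLoc` FIELD AT `𝔠₀`**: the archimedean coordinate `x.1 : Cinf` is a coh-unitary class and every finite coordinate
`x.2 v ∈ Irr(U(H)(L⁺_v))`, `v ∈ S`, is unitarizable (★ `IrrClass.IsUnitarizable`) — the hypothesis under which Prop. 13.8.1 (linear independence of characters
of irreducible UNITARY representations of `G′_ι × ∏_{v ∈ S} G′_v`) is printed. [cite: Rogawski1990, Prop. 13.8.1 p. 206] -/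
def unitaryLoc₀ (S : Finset (HeightOneSpectrum (𝓞 ↥(maximalRealSubfield L))))
    (x : Cinf × (∀ v : ↥S, IrrClass ((cmDatum L 3 H).Local v.1))) : Prop :=
  IsCohUnitaryClass x.1 ∧ ∀ v : ↥S, (x.2 v).IsUnitarizable

/-- Unfolding `unitaryLoc₀` (definitional). [cite: Rogawski1990, Prop. 13.8.1 p. 206] -/
theorem unitaryLoc₀_iff (S : Finset (HeightOneSpectrum (𝓞 ↥(maximalRealSubfield L))))
    (x : Cinf × (∀ v : ↥S, IrrClass ((cmDatum L 3 H).Local v.1))) :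
    unitaryLoc₀ L H S x ↔ IsCohUnitaryClass x.1 ∧ ∀ v : ↥S, (x.2 v).IsUnitarizable :=
  Iff.rfl

end Frame

/-! ## §3 The unitarity-first archimedean token `clInfChoiceU` -/

section Token

variable (L : Type) [Field L] [NumberField L] [IsCMField L] (H : Matrix (Fin 3) (Fin 3) L) (ι : L →+* ℂ) (T : GL (Fin 3) ℂ)
  (hT : (T : Matrix (Fin 3) (Fin 3) ℂ)ᴴ * H.map ι * (T : Matrix (Fin 3) (Fin 3) ℂ) = Literature.Geometry.ComplexHyperbolic.BallModel.J)
  (μ : Measure (Gp L H).automorphicQuotient) [(Gp L H).IsAutomorphicMeasure μ]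

/-- **`clInfChoiceU dflt P` — THE UNITARITY-FIRST ARCHIMEDEAN CLASS TOKEN of `P` at `ι`** (RULING (V24)(d1) pattern for the archimedean place): the
`(𝔤, K)`-class of SOME token of `P` (★ `HasToken`: a non-zero `(𝔤, K)`-map `P.archModuleCM ι T hT → M`) whose target is COH-UNITARY (★ `IsCohUnitaryIrrep`),
if such a token exists, else the junk value `dflt`.  In print every token target of an automorphic `π′` is (the Harish-Chandra module of) its unitary
archimedean component `π′_ι`, so the first branch always fires [HarishChandra1953 Thm. 9; Rogawski1990 §14.5 p. 237]; at `𝔠₀`: `clInf c := clInfChoiceU dflt (rep c)`.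
[cite: Rogawski1990, §14.5 p. 237] [cite: HarishChandra1953, Thm. 9] -/
def clInfChoiceU (dflt : Cinf) (P : DiscreteAutomorphicRep (Gp L H) μ) : Cinf :=
  open scoped Classical in
  if h : ∃ r : GKIrrep (uFormGroup (Fin 2) (Fin 1)), HasToken L H ι T hT μ P r.V r.ρK r.ρ𝔤 ∧ IsCohUnitaryIrrep r.ρK r.ρ𝔤
  then GKIrrClass.mk h.choose else dflt

/-- **Branch 1**: if `P` has a coh-unitary token, `clInfChoiceU dflt P` is the class of one. [cite: Rogawski1990, §14.5 p. 237] -/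
theorem exists_spec_clInfChoiceU_eq (dflt : Cinf) (P : DiscreteAutomorphicRep (Gp L H) μ)
    (h : ∃ r : GKIrrep (uFormGroup (Fin 2) (Fin 1)), HasToken L H ι T hT μ P r.V r.ρK r.ρ𝔤 ∧ IsCohUnitaryIrrep r.ρK r.ρ𝔤) :
    ∃ r : GKIrrep (uFormGroup (Fin 2) (Fin 1)), HasToken L H ι T hT μ P r.V r.ρK r.ρ𝔤 ∧ IsCohUnitaryIrrep r.ρK r.ρ𝔤 ∧
      clInfChoiceU L H ι T hT μ dflt P = GKIrrClass.mk r := by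
  classical
  refine ⟨h.choose, h.choose_spec.1, h.choose_spec.2, ?_⟩
  unfold clInfChoiceU
  rw [dif_pos h]

/-- **Branch 2**: without a coh-unitary token, `clInfChoiceU dflt P = dflt`. [cite: Rogawski1990, §14.5 p. 237] -/
theorem clInfChoiceU_of_not (dflt : Cinf) (P : DiscreteAutomorphicRep (Gp L H) μ)
    (h : ¬ ∃ r : GKIrrep (uFormGroup (Fin 2) (Fin 1)), HasToken L H ι T hT μ P r.V r.ρK r.ρ𝔤 ∧ IsCohUnitaryIrrep r.ρK r.ρ𝔤) :
    clInfChoiceU L H ι T hT μ dflt P = dflt := by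
  classical
  unfold clInfChoiceU
  rw [dif_neg h]

/-- **`clInfChoiceU dflt P` is a COH-UNITARY class in BOTH branches** (given a coh-unitary `dflt`). [cite: Rogawski1990, Prop. 13.8.1 p. 206] -/
theorem isCohUnitaryClass_clInfChoiceU {dflt : Cinf} (hdflt : IsCohUnitaryClass dflt) (P : DiscreteAutomorphicRep (Gp L H) μ) :
    IsCohUnitaryClass (clInfChoiceU L H ι T hT μ dflt P) := by
  by_cases h : ∃ r : GKIrrep (uFormGroup (Fin 2) (Fin 1)), HasToken L H ι T hT μ P r.V r.ρK r.ρ𝔤 ∧ IsCohUnitaryIrrep r.ρK r.ρ𝔤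
  · obtain ⟨r, -, hr, hreq⟩ := exists_spec_clInfChoiceU_eq L H ι T hT μ dflt P h
    rw [hreq]
    exact isCohUnitaryClass_mk hr
  · rw [clInfChoiceU_of_not L H ι T hT μ dflt P h]
    exact hdflt

/-! ## §4 Law `UnitaryCoord` at `𝔠₀`, unconditionally -/

/-- **LAW `UnitaryCoord` AT `𝔠₀` — EVERY CLASS HAS UNITARY COORDINATES OF RECORD**, token for token the body of `ClassificationKit.UnitaryCoord` (v5 :407)
at `UnitaryLoc := unitaryLoc₀ L H`, `clInf c := clInfChoiceU … dflt (rep c)`, `clFin c v := clFinChoice (rep c) v`: the archimedean coordinate is coh-unitary by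
§3 (`dflt` coh-unitary) and every finite coordinate is unitarizable by ★ p819116 `clFinChoice_isUnitarizable` (all three branches).  UNCONDITIONAL: no letter,
no guard. [cite: Rogawski1990, Prop. 13.8.1 p. 206; §14.5 p. 237] -/
theorem unitaryCoord₀ {dflt : Cinf} (hdflt : IsCohUnitaryClass dflt) :
    ∀ (S : Finset (HeightOneSpectrum (𝓞 ↥(maximalRealSubfield L)))) (c : Cls (Gp L H) μ),
      unitaryLoc₀ L H S (clInfChoiceU L H ι T hT μ dflt (rep (Gp L H) μ c), fun v => clFinChoice (rep (Gp L H) μ c) v.1) :=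
  fun _ c => ⟨isCohUnitaryClass_clInfChoiceU L H ι T hT μ hdflt (rep (Gp L H) μ c), fun v => clFinChoice_isUnitarizable (rep (Gp L H) μ c) v.1⟩

/-- **`UnitaryCoord` at `𝔠₀` with the junk value of record `dflt := [J⁺] = archDegOneClass 1`** (★ X1′). [cite: Rogawski1990, Prop. 13.8.1 p. 206; Prop. 15.2.1 (b)] -/
theorem unitaryCoord₀_archDegOne :
    ∀ (S : Finset (HeightOneSpectrum (𝓞 ↥(maximalRealSubfield L)))) (c : Cls (Gp L H) μ),
      unitaryLoc₀ L H S (clInfChoiceU L H ι T hT μ (archDegOneClass 1 (Or.inl rfl)) (rep (Gp L H) μ c), fun v => clFinChoice (rep (Gp L H) μ c) v.1) :=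
  unitaryCoord₀ L H ι T hT μ (isCohUnitaryClass_archDegOneClass 1 (Or.inl rfl))

/-! ## §5 Law `TokenInf` for the unitarity-first token, modulo F1a for `P` and one coh-unitary token; the holomorphic instance -/

/-- **`clInfChoiceU` pins every token of `P`** when `P` satisfies F1a at the CM frame and HAS a coh-unitary token: for any token `(M, σK, σ𝔤)` of `P`,
`clInfChoiceU dflt P = GKIrrClass.ofModule M σK σ𝔤` (the chosen coh-unitary token and `M` are two tokens of ONE `P`, hence `(𝔤, K)`-equivalent, ★
`F0P3ArchTokenSeam.areGKEquivalent_of_tokens`). [cite: FlathCorvallis1979, Thm. 3 and Thm. 4] [cite: Rogawski1990, §15.3] -/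
theorem clInfChoiceU_eq_ofModule (dflt : Cinf) (P : DiscreteAutomorphicRep (Gp L H) μ)
    (hF1a : P.ArchIsotypy (uFormGroup (Fin 2) (Fin 1)) (cmArchSectionUForm L ι H T hT))
    (hex : ∃ r : GKIrrep (uFormGroup (Fin 2) (Fin 1)), HasToken L H ι T hT μ P r.V r.ρK r.ρ𝔤 ∧ IsCohUnitaryIrrep r.ρK r.ρ𝔤)
    {M : Type} [AddCommGroup M] [Module ℂ M] {σK : Representation ℂ (uFormGroup (Fin 2) (Fin 1)).maximalCompact M}
    {σ𝔤 : (uFormGroup (Fin 2) (Fin 1)).lie →ₗ⁅ℝ⁆ Module.End ℂ M} (hM : IsGKModule (uFormGroup (Fin 2) (Fin 1)) σK σ𝔤) (hirr : IsIrreducibleGK σK σ𝔤)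
    (htok : HasToken L H ι T hT μ P M σK σ𝔤) :
    clInfChoiceU L H ι T hT μ dflt P = GKIrrClass.ofModule M σK σ𝔤 hM hirr := by
  have h₁ := exists_spec_clInfChoiceU_eq L H ι T hT μ dflt P hex
  rcases h₁ with ⟨r, hr, -, hreq⟩
  rw [hreq, GKIrrClass.ofModule_eq_mk, GKIrrClass.mk_eq_mk_iff]
  obtain ⟨T₁, hT₁K, hT₁𝔤, hT₁⟩ := hr
  obtain ⟨T₂, hT₂K, hT₂𝔤, hT₂⟩ := htok
  exact F0P3ArchTokenSeam.areGKEquivalent_of_tokens ι T hT P hF1a r.isIrreducible T₁ hT₁K hT₁𝔤 hT₁ hirr T₂ hT₂K hT₂𝔤 hT₂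

/-- **LAW `TokenInf` SHAPE for `clInf c := clInfChoiceU dflt (rep c)`**: if `P` satisfies F1a at the CM frame and has a coh-unitary token, then every token
`(M, σK, σ𝔤)` of `P` pins `clInfChoiceU dflt (rep (cl P)) = GKIrrClass.ofModule M σK σ𝔤` (tokens of `P` and of `rep (cl P) ≃ P` correspond, ★ `hasToken_rep_cl_iff`).
[cite: FlathCorvallis1979, Thm. 3 and Thm. 4] [cite: Rogawski1990, §14.6 (14.6.3) and §15.3] -/
theorem tokenInfU_of_exists_cohUnitaryToken (dflt : Cinf) (P : DiscreteAutomorphicRep (Gp L H) μ)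
    (hF1a : P.ArchIsotypy (uFormGroup (Fin 2) (Fin 1)) (cmArchSectionUForm L ι H T hT))
    (hex : ∃ r : GKIrrep (uFormGroup (Fin 2) (Fin 1)), HasToken L H ι T hT μ P r.V r.ρK r.ρ𝔤 ∧ IsCohUnitaryIrrep r.ρK r.ρ𝔤)
    {M : Type} [AddCommGroup M] [Module ℂ M] {σK : Representation ℂ (uFormGroup (Fin 2) (Fin 1)).maximalCompact M}
    {σ𝔤 : (uFormGroup (Fin 2) (Fin 1)).lie →ₗ⁅ℝ⁆ Module.End ℂ M} (hM : IsGKModule (uFormGroup (Fin 2) (Fin 1)) σK σ𝔤) (hirr : IsIrreducibleGK σK σ𝔤)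
    (htok : HasToken L H ι T hT μ P M σK σ𝔤) :
    clInfChoiceU L H ι T hT μ dflt (rep (Gp L H) μ (cl (Gp L H) μ P)) = GKIrrClass.ofModule M σK σ𝔤 hM hirr := by
  -- the coh-unitary token of `P` is one of `rep (cl P)`
  have hex' : ∃ r : GKIrrep (uFormGroup (Fin 2) (Fin 1)),
      HasToken L H ι T hT μ (rep (Gp L H) μ (cl (Gp L H) μ P)) r.V r.ρK r.ρ𝔤 ∧ IsCohUnitaryIrrep r.ρK r.ρ𝔤 := by
    obtain ⟨r, hr, hru⟩ := hex
    exact ⟨r, (hasToken_rep_cl_iff L H ι T hT μ P).2 hr, hru⟩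
  have h₁ := exists_spec_clInfChoiceU_eq L H ι T hT μ dflt _ hex'
  rcases h₁ with ⟨r, hr, -, hreq⟩
  rw [hreq, GKIrrClass.ofModule_eq_mk, GKIrrClass.mk_eq_mk_iff]
  -- both `r` (transported back to `P`) and `M` are tokens of `P`
  obtain ⟨T₁, hT₁K, hT₁𝔤, hT₁⟩ := (hasToken_rep_cl_iff L H ι T hT μ P).1 hr
  obtain ⟨T₂, hT₂K, hT₂𝔤, hT₂⟩ := htok
  exact F0P3ArchTokenSeam.areGKEquivalent_of_tokens ι T hT P hF1a r.isIrreducible T₁ hT₁K hT₁𝔤 hT₁ hirr T₂ hT₂K hT₂𝔤 hT₂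

/-- **LAW `TokenInf` AT `𝔠₀` for `clInfChoiceU`, HOLOMORPHIC INSTANCE** (compact CM frame `hdef`, `h2`): a holomorphic-cotangent discrete `P` satisfies F1a in-house
(★ `archIsotypy_of_isHolCotangentAt`) and has a coh-unitary token (★ `exists_cohUnitaryIrrep_token_of_isHolCotangentAt_cpt`), so every token `(M, σK, σ𝔤)` of `P` pins
`clInfChoiceU dflt (rep (cl P)) = GKIrrClass.ofModule M σK σ𝔤`. [cite: Rogawski1990, Prop. 15.2.1 (b); §15.3] [cite: BorelWallach2000, VI Thm. 4.11] -/
theorem tokenInfU_of_isHolCotangentAt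
    (hdef : ∀ τ' : L →+* ℂ, InfinitePlace.mk τ' ≠ InfinitePlace.mk ι → (H.map τ').PosDef) (h2 : 2 ≤ Module.finrank ℚ ↥(maximalRealSubfield L))
    (dflt : Cinf) (P : DiscreteAutomorphicRep (Gp L H) μ) (hP : P.IsHolCotangentAt (cmArchSection L ι H T hT) (cmCompactFactor L ι H T hT))
    {M : Type} [AddCommGroup M] [Module ℂ M] {σK : Representation ℂ (uFormGroup (Fin 2) (Fin 1)).maximalCompact M}
    {σ𝔤 : (uFormGroup (Fin 2) (Fin 1)).lie →ₗ⁅ℝ⁆ Module.End ℂ M} (hM : IsGKModule (uFormGroup (Fin 2) (Fin 1)) σK σ𝔤) (hirr : IsIrreducibleGK σK σ𝔤)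
    (htok : HasToken L H ι T hT μ P M σK σ𝔤) :
    clInfChoiceU L H ι T hT μ dflt (rep (Gp L H) μ (cl (Gp L H) μ P)) = GKIrrClass.ofModule M σK σ𝔤 hM hirr := by
  have hF1a := F0P3StubF1aHolHalf.archIsotypy_of_isHolCotangentAt ι T hT hdef h2 μ P hP
  have hct := F0P3ArchTokenUnitary.exists_cohUnitaryIrrep_token_of_isHolCotangentAt_cpt ι T hT hdef h2 μ P hP
  obtain ⟨M₀, _, _, σK₀, σ𝔤₀, hM₀, hT₀, -⟩ := hct
  exact tokenInfU_of_exists_cohUnitaryToken L H ι T hT μ dflt P hF1a ⟨⟨M₀, σK₀, σ𝔤₀, hM₀.gk, hM₀.irred⟩, hT₀, hM₀⟩ hM hirr htok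

end Token

end Summit.HodgeConjecture.HodgeConjecture.Cruxes.H413.F0P3UnitaryLocOfRecord
end
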